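import Summits.CriticalPhenomena.PercolationContinuityZ3.Theorems.PercNearOneGluingNoHeavyQuantFarSunGameAvg
import Summits.CriticalPhenomena.PercolationContinuityZ3.Theorems.PercNearOneGluingNoHeavyQuantFarSunWitnessPrefix
import Summits.CriticalPhenomena.PercolationContinuityZ3.Theorems.PercNearOneGluingNoHeavyQuantFarSunRegionsB
import Summits.CriticalPhenomena.PercolationContinuityZ3.Theorems.PercNearOneGluingNoHeavyQuantFarSunAvgLargeSigma
import Summits.CriticalPhenomena.PercolationContinuityZ3.Theorems.PercNearOneGluingNoHeavyQuantFarSunCertBoxes2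
import Summits.CriticalPhenomena.PercolationContinuityZ3.Theorems.PercNearOneGluingNoHeavyQuantFarSunCertCells171819
import Mathlib.Tactic.Linarith
import HarnessLib

/-!
# FAR beyond trees: LAYER 2 IN THE MIDDLE RANGE — from game certificates to hair-only certificates on `R` (the pattern, `K = 17`, and all `K ≥ 20`)

builds on p205010 (kernel theorem, internal audit signed; external expert review pending)

Support file (`--supports stmt-CriticalPhenomena-4575`), seat `prim-cert-1` (gen 39); memo `prim-cert-1/FROM-prim-cert-1-g39-VERTEX-GAME.md` §4 (L5), §5.
* `HairyCycle.budget_window` — for a cell box (`g_{c k} ≤ h k ≤ g_{c k+1}`) whose letters/weights satisfy `g_{j+1} ≤ w_j·υ`, `g_{j+1} ≤ w_{j+1}·υ`, `w_j ≤ wmax`,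
  every vertex word `u` has `Σh ≤ υ·Σ_k w(u k)` and `Σ_k w(u k) ≤ K·wmax`; hence with `S < Σh`, `(B_min − 1)υ ≤ S` its budget lies in `[B_min, K·wmax]`.
* **`HairyCycle.witGavg_ge_one_of_cellGame`** — the generic Region II step: certificate on budgets `B_min … K·wmax` + cell box + slab bound ⇒ `1 ≤ witGavg K h 2`.
* **`HairyCycle.hairCert_two_of_R_17`** — THE PATTERN for `12 ≤ K ≤ 19` at `K = 17`: on `R` (`4 < Σ`), either `Σ ≥ 14` (LEMMA 1 `witGavg_ge_one_of_sum_ge`), or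
  `η ≥ 3/16` (box certificate `boxCert_17`), or `η ∈ (2/13, 3/16)` ⊂ cell `[3/20, 3/16)` (slab `slab_17_0` + `cellCert_17_0`); in all cases `1 ≤ witGavg 17 h 2`,
  hence a hair-only certificate (`hairCert_of_witAvg`).
* **`HairyCycle.hairCert_two_of_R_ge_twenty`** — ALL `K ≥ 20`: on `R`, `Σ ≥ 14` (LEMMA 1) or `η > 2/13 > 3/20`, then the first twenty hairs lie in the box of
  `boxCert_20`, so `1 ≤ witGavg 20 h 2 ≤ witG K h 2 (prefixSel 20 2 (minSel h 2))` (`witG_prefix_ge_one`) and `hairCert_of_witness` applies.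
The remaining `K = 12 … 16, 18, 19` follow the `K = 17` pattern with their boxes/cells (separate files); the final assembly with THM B off `R` is `…LayerTwoAll`.
Elementary [this work]; no sorries; standard axioms (+ `Lean.ofReduceBool` through the certificates).
-/

noncomputable section

namespace Summit.CriticalPhenomena.PercolationContinuityZ3.Theorems.HairyCycle

open Finset

variable {K : ℕ}

/-! ## Budgets of the vertex words of a cell box -/

/-- **Budget window.**  If `g_{c k} ≤ h k ≤ g_{c k+1}` (`k < K`), the weights dominate the next letter (`g_{j+1} ≤ w_j υ`, `g_{j+1} ≤ w_{j+1} υ` for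
`j + 1 < nL`) and `w_j ≤ wmax` (`j < nL`), then every vertex word `u` (`u k ∈ {c k, c k+1}`, `c k + 1 < nL`) satisfies
`Σ_{k<K} h k ≤ υ · Σ_k w(u k)` and `Σ_k w(u k) ≤ K · wmax`. [this work] -/
theorem budget_window (P : GameSpec) {υ : ℝ} {wmax : ℕ}
    (hwt : ∀ j, j + 1 < P.nL → P.gOf (j + 1) ≤ P.wOf j * υ ∧ P.gOf (j + 1) ≤ P.wOf (j + 1) * υ)
    (hwmax : ∀ j, j < P.nL → P.wOf j ≤ wmax) (c : ℕ → ℕ) (hcL : ∀ k, k < K → c k + 1 < P.nL)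
    {h : ℕ → ℝ} (hh : ∀ k, k < K → P.gOf (c k) ≤ h k ∧ h k ≤ P.gOf (c k + 1))
    (u : ℕ → ℕ) (hu : ∀ k, k < K → u k = c k ∨ u k = c k + 1) :
    ∑ k ∈ range K, h k ≤ υ * ((((List.range K).map u).map P.wOf).sum : ℕ) ∧ (((List.range K).map u).map P.wOf).sum ≤ K * wmax := by
  have hsum : ((((List.range K).map u).map P.wOf).sum : ℕ) = ∑ k ∈ range K, P.wOf (u k) := by
    rw [List.map_map, ← List.sum_toFinset _ (List.nodup_range), List.toFinset_range]
    simp [Function.comp]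
  constructor
  · rw [hsum]
    push_cast
    rw [Finset.mul_sum]
    refine Finset.sum_le_sum fun k hk => ?_
    have hkK := Finset.mem_range.1 hk
    obtain ⟨h1, h2⟩ := hwt (c k) (hcL k hkK)
    rcases hu k hkK with e | e <;> rw [e]
    · linarith [(hh k hkK).2]
    · linarith [(hh k hkK).2]
  · rw [hsum]
    calc ∑ k ∈ range K, P.wOf (u k) ≤ ∑ k ∈ range K, wmax := Finset.sum_le_sum fun k hk => by
            have hkK := Finset.mem_range.1 hk
            rcases hu k hkK with e | e <;> rw [e]
            · exact hwmax _ (by have := hcL k hkK; omega)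
            · exact hwmax _ (hcL k hkK)
      _ = K * wmax := by simp

/-- **Generic Region II step.**  A well-formed game `P` (`5 ≤ Amax`, `K ≤ Kcred`, `2 ≤ K`) whose certificate passes on the budgets `B_min, …, K·wmax`
(table size `K·wmax`), a cell assignment `c` with `g_{c k} ≤ h k ≤ g_{c k+1}`, `0 < h`, letters/weights as in `budget_window` with unit `υ > 0`, and the slab
facts `S < Σh`, `(B_min − 1)·υ ≤ S` give `1 ≤ witGavg K h 2`. [this work] -/
theorem witGavg_ge_one_of_cellGame {P : GameSpec} (W : P.WF) (hA5 : 5 ≤ P.Amax) (hKc : K ≤ P.Kcred) (hK : 2 ≤ K)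
    {wmax Bmin : ℕ} (hc : P.gameCert (K * wmax) K (List.range' Bmin (K * wmax - Bmin + 1)) = true)
    {υ S : ℝ} (hυ : 0 < υ) (hwt : ∀ j, j + 1 < P.nL → P.gOf (j + 1) ≤ P.wOf j * υ ∧ P.gOf (j + 1) ≤ P.wOf (j + 1) * υ)
    (hwmax : ∀ j, j < P.nL → P.wOf j ≤ wmax) (c : ℕ → ℕ) (hcL : ∀ k, k < K → c k + 1 < P.nL)
    {h : ℕ → ℝ} (hh : ∀ k, k < K → P.gOf (c k) ≤ h k ∧ h k ≤ P.gOf (c k + 1)) (hpos : ∀ k, k < K → 0 < h k)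
    (hS : S < ∑ k ∈ range K, h k) (hB : ((Bmin : ℝ) - 1) * υ ≤ S) : 1 ≤ witGavg K h 2 := by
  refine witGavg_ge_one_of_cellCert W hA5 hKc hK hc c hcL (fun u hu => ?_) hh hpos
  obtain ⟨hlo, hhi⟩ := budget_window P hwt hwmax c hcL hh u hu
  set B := (((List.range K).map u).map P.wOf).sum with hBdef
  have hBmin : Bmin ≤ B := by
    have h1 : ((Bmin : ℝ) - 1) * υ < υ * (B : ℝ) := lt_of_le_of_lt hB (lt_of_lt_of_le hS hlo)
    have h2 : (Bmin : ℝ) - 1 < B := by nlinarith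
    have h3 : (Bmin : ℝ) < (B : ℝ) + 1 := by linarith
    exact_mod_cast Nat.lt_succ_iff.1 (by exact_mod_cast h3)
  exact ⟨List.mem_range'_1.2 ⟨hBmin, by omega⟩, hhi⟩

/-! ## The pattern at `K = 17` -/

/-- `K = 17`: on `R` (`h ∈ [0,1]` everywhere, least weight `h m`, `4 < Σ`, `2(F − η) < η(Σ−4)`) the averaged witness weight is `≥ 1`. [this work] -/
theorem witGavg_ge_one_of_R_17 {h : ℕ → ℝ} (hh : ∀ k, 0 ≤ h k ∧ h k ≤ 1) {m : ℕ} (hmin : ∀ k, k < 17 → h m ≤ h k)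
    (hS4 : (4 : ℝ) < ∑ k ∈ range 17, h k) (hR : 2 * (hairV 17 h 2 (range 17) - h m) < h m * (∑ k ∈ range 17, h k - 4)) :
    1 ≤ witGavg 17 h 2 := by
  have hh' : ∀ k, k < 17 → 0 ≤ h k ∧ h k ≤ 1 := fun k _ => hh k
  by_cases h14 : 14 ≤ ∑ k ∈ range 17, h k
  · -- LEMMA 1 (large mass)
    have hpos : ∀ k, k < 17 → 0 < h k ∧ h k ≤ 1 := by
      intro k hk
      have hη := eta_mul_gt_two_of_R hh hmin hS4 hR
      have hη0 : 0 < h m := by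
        by_contra h0; push Not at h0
        have : h m = 0 := le_antisymm h0 (hh m).1
        rw [this] at hη; linarith
      exact ⟨lt_of_lt_of_le hη0 (hmin k hk), (hh k).2⟩
    exact witGavg_ge_one_of_sum_ge hpos h14
  · push Not at h14
    have hη : (2 : ℝ) / 13 < h m := eta_gt_of_R_of_sum_lt hh hmin hS4 h14 hR
    have hpos : ∀ k, k < 17 → 0 < h k := fun k hk => lt_of_lt_of_le (by linarith) (hmin k hk)
    by_cases hbox : (3 : ℝ) / 16 ≤ h m
    · -- Region I: the box `[3/16, 1]^17`
      exact witGavg_ge_one_of_boxCert boxWF_17 (by decide) (by decide) (by decide) le_rfl (by decide) rfl boxCert_17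
        (fun k hk => ⟨by push_cast; linarith [hmin k hk], (hh k).2⟩)
    · push Not at hbox
      -- Region II: cell `[3/20, 3/16)`, letters `3/20 < 1/2 < 3/4 < 1`, weights `2,3,4,4`, unit `1/4`, budgets `51 … 68`
      have hslab := slab_17_0 hh hbox hS4 hR
      classical
      let c : ℕ → ℕ := fun k => if h k ≤ 1 / 2 then 0 else if h k ≤ 3 / 4 then 1 else 2
      have hg0 : GameSpec.gOf (⟨8, 2, 3, 17, 20, 84, [(3, 2), (10, 3), (15, 4), (20, 4)]⟩ : GameSpec) 0 = 3 / 20 := by norm_num [GameSpec.gOf, GameSpec.kOf]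
      have hg1 : GameSpec.gOf (⟨8, 2, 3, 17, 20, 84, [(3, 2), (10, 3), (15, 4), (20, 4)]⟩ : GameSpec) 1 = 1 / 2 := by norm_num [GameSpec.gOf, GameSpec.kOf]
      have hg2 : GameSpec.gOf (⟨8, 2, 3, 17, 20, 84, [(3, 2), (10, 3), (15, 4), (20, 4)]⟩ : GameSpec) 2 = 3 / 4 := by norm_num [GameSpec.gOf, GameSpec.kOf]
      have hg3 : GameSpec.gOf (⟨8, 2, 3, 17, 20, 84, [(3, 2), (10, 3), (15, 4), (20, 4)]⟩ : GameSpec) 3 = 1 := by norm_num [GameSpec.gOf, GameSpec.kOf]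
      refine witGavg_ge_one_of_cellGame (K := 17) (P := (⟨8, 2, 3, 17, 20, 84, [(3, 2), (10, 3), (15, 4), (20, 4)]⟩ : GameSpec)) cellWF_17_0 (by decide) (by decide) (by decide) (wmax := 4) (Bmin := 51)
        cellCert_17_0 (υ := 1 / 4) (S := 12583 / 1000) (by norm_num) ?_ ?_ c ?_ ?_ hpos (by norm_num at hslab ⊢; linarith) (by norm_num)
      · intro j hj
        have hj3 : j < 3 := by change j + 1 < 4 at hj; omega
        interval_cases j
        · rw [hg1]; norm_num [GameSpec.wOf]
        · rw [hg2]; norm_num [GameSpec.wOf]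
        · rw [hg3]; norm_num [GameSpec.wOf]
      · intro j hj
        have hj4 : j < 4 := hj
        interval_cases j <;> decide
      · intro k _
        simp only [c]; split_ifs <;> decide
      · intro k hk
        have hlo : 3 / 20 ≤ h k := by linarith [hmin k hk]
        have hup : h k ≤ 1 := (hh k).2
        simp only [c]
        split_ifs with h1 h2
        · exact ⟨by rw [hg0]; exact hlo, by rw [hg1]; exact h1⟩
        · exact ⟨by rw [hg1]; linarith, by rw [hg2]; exact h2⟩
        · exact ⟨by rw [hg2]; linarith, by rw [hg3]; exact hup⟩

/-- **`K = 17`: a hair-only certificate on `R`.** [this work] -/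
theorem hairCert_two_of_R_17 {h : ℕ → ℝ} (hh : ∀ k, 0 ≤ h k ∧ h k ≤ 1) {m : ℕ} (hmin : ∀ k, k < 17 → h m ≤ h k)
    (hS4 : (4 : ℝ) < ∑ k ∈ range 17, h k) (hR : 2 * (hairV 17 h 2 (range 17) - h m) < h m * (∑ k ∈ range 17, h k - 4)) :
    ∃ lam : ℕ → ℝ, ∃ μ : ℝ, (∀ k, 0 ≤ lam k) ∧ ∑ k ∈ range 17, lam k = 1 ∧ 0 ≤ μ ∧
      ∀ p ∈ arcIx 17, ∑ k ∈ cov 17 p.1 p.2, lam k * h k + μ * (∑ k ∈ cov 17 p.1 p.2, h k - 2 * (2 : ℕ)) ≤ hairV 17 h 2 (cov 17 p.1 p.2) :=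
  hairCert_of_witAvg (fun k _ => hh k) (witGavg_ge_one_of_R_17 hh hmin hS4 hR)

/-! ## All `K ≥ 20` -/

/-- **`K ≥ 20`: a hair-only certificate on `R`** — LEMMA 1 if `Σ ≥ 14`; otherwise `η > 2/13`, the first twenty hairs lie in the box of `boxCert_20`,
and the prefix universal-witness rule applies. [this work] -/
theorem hairCert_two_of_R_ge_twenty (hK : 20 ≤ K) {h : ℕ → ℝ} (hh : ∀ k, 0 ≤ h k ∧ h k ≤ 1) {m : ℕ}
    (hmin : ∀ k, k < K → h m ≤ h k) (hS4 : (4 : ℝ) < ∑ k ∈ range K, h k)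
    (hR : 2 * (hairV K h 2 (range K) - h m) < h m * (∑ k ∈ range K, h k - 4)) :
    ∃ lam : ℕ → ℝ, ∃ μ : ℝ, (∀ k, 0 ≤ lam k) ∧ ∑ k ∈ range K, lam k = 1 ∧ 0 ≤ μ ∧
      ∀ p ∈ arcIx K, ∑ k ∈ cov K p.1 p.2, lam k * h k + μ * (∑ k ∈ cov K p.1 p.2, h k - 2 * (2 : ℕ)) ≤ hairV K h 2 (cov K p.1 p.2) := by
  have hh' : ∀ k, k < K → 0 ≤ h k ∧ h k ≤ 1 := fun k _ => hh k
  have hηpos : 0 < h m := by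
    have hη := eta_mul_gt_two_of_R hh hmin hS4 hR
    by_contra h0; push Not at h0
    have : h m = 0 := le_antisymm h0 (hh m).1
    rw [this] at hη; linarith
  have hpos : ∀ k, k < K → 0 < h k ∧ h k ≤ 1 := fun k hk => ⟨lt_of_lt_of_le hηpos (hmin k hk), (hh k).2⟩
  by_cases h14 : 14 ≤ ∑ k ∈ range K, h k
  · exact hairCert_of_witAvg hh' (witGavg_ge_one_of_sum_ge hpos h14)
  · push Not at h14
    have hη : (2 : ℝ) / 13 < h m := eta_gt_of_R_of_sum_lt hh hmin hS4 h14 hR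
    -- the first 20 hairs are in the box `[3/20, 1]^20`
    have hbox : 1 ≤ witGavg 20 h 2 :=
      witGavg_ge_one_of_boxCert boxWF_20 (by decide) (by decide) (by decide) le_rfl (by decide) rfl boxCert_20
        (fun k hk => ⟨by push_cast; linarith [hmin k (lt_of_lt_of_le hk hK)], (hh k).2⟩)
    have hG := witG_prefix_ge_one (K := K) hpos hK hbox
    exact hairCert_of_witness hh' _ (fun Q _ hQ => prefixSel_mem_wit (K₀ := 20) (minSel_valid (K := 20) h 2) Q hQ) hG

end Summit.CriticalPhenomena.PercolationContinuityZ3.Theorems.HairyCycle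

end
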